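import Summits.ResolutionOfSingularities.ResolutionOfSingularities.Theorems.DescentPerfectToAll.Negative.ConstantsOfTwistedDerivation
import Mathlib.Algebra.Field.ZMod
import HarnessLib

/-!
# `DescentPerfectToAll` — negative lemma, part 2: the ring of constants of a NON-p-closed
nonsingular derivation of a regular local ring need not be regular

Support (negative) lemma for crux `stmt-ResolutionOfSingularities-0549`
(`Summit.ResolutionOfSingularities.ResolutionOfSingularities.Theses.WeightedInvariant.DescentPerfectToAll`),
filed by the standing disprover (cdisprove gen 3). It closes the one `sorry` of
`Cruxes/DescentPerfectToAll/Disproof.lean` §8 (`not_invariantsRegularOfNonsingularDerivation`): the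
FIRST LEMMA of crux-idea card `constant-foliation-descent` (SketchIdeator1; re-used by the merged line
constant-foliation-descent ≈ frobenius-sandwich-foliation ≈ root-of-a-constant of triage round 1),

  `InvariantsRegularOfNonsingularDerivation p` : for every regular local ring `R` of characteristic
  `p`, every derivation `D : Derivation ℤ R R`, and `S = ker D` with `R` module-finite over `S` and
  `D x` a unit for some `x`, the ring `S` is regular local,

is FALSE for every prime `p` (all three round-1 triagers flagged it on paper; here it is
kernel-checked; this file declares NO definition — the derivation `D`, its equation `hD`, the test
exponents `E` and their equation `hE` are variables, instantiated in the last theorem). WITNESS: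
`R = 𝔽_p⟦X₀, X₁, X₂⟧` (regular local of dimension 3: `isRegularLocalRing_mvPowerSeries`,
`ringKrullDim_mvPowerSeries`), `D = ∂₀ + X₀·(X₁∂₁ + X₂∂₂)` (part 1,
`ConstantsOfTwistedDerivation.lean`): `D X₀ = 1`; `R` is module-finite over `S = ker D`, so
`dim S = 3` (`ringKrullDim_eq_of_isIntegral`); for a constant `s` and any `g` without constant term
the coefficients of the four TEST MONOMIALS `X₀^p, X₁^p, X₁^{p-1}X₂, X₂^p` (exponents `E`) in `s·g`
are `s(0)` times those of `g` (`coeff_E_mul`, from the low-degree vanishing of part 1); the test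
monomials are constants in `𝔪_S`, so the `𝔽_p`-linear test functional `Λ : R → 𝔽_p⁴` maps `𝔪_S`
onto `𝔽_p⁴` while `Λ(𝔪_S) ⊆ span(Λ gᵢ)` for any generators `(gᵢ)` of `𝔪_S`; regularity would give
three generators (`spanFinrank 𝔪_S = dim S = 3`): `4 ≤ 3` (`not_isRegularLocalRing_constants`). The
REPAIRED lemma with p-closedness `D^p ∈ R·D` (Aramova–Avramov's hypothesis: then `R` is free over
`S` on `1, x, …, x^{p-1}` and regularity descends by flatness) is what the line must use — this file
certifies that p-closedness is load-bearing (`D^p = X₀^p(X₁∂₁ + X₂∂₂) ∉ R·D` here).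

## Sources
* A. G. Aramova, L. L. Avramov, Singularities of quotients by vector fields in characteristic `p`,
  Math. Ann. 273 (1986) 629–645. [folklore computation here]
* H. Matsumura, *Commutative Ring Theory*, CUP 1986, Thm. 14.2 / §19 (regular local rings).
  [Matsumura1987]
-/

noncomputable section

open MvPowerSeries IsLocalRing Finsupp
open Literature.AlgebraicGeometry.Resolution

set_option linter.dupNamespace false

namespace Summit.ResolutionOfSingularities.ResolutionOfSingularities.Theorems.DescentPerfectToAll.Negative

variable (k : Type) [Field k]
variable (D : Derivation k (MvPowerSeries (Fin 3) k) (MvPowerSeries (Fin 3) k))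
  (hD : D = MvPowerSeries.pderiv 0 +
    (X 0 : MvPowerSeries (Fin 3) k) • (MvPowerSeries.eulerDerivation 1 + MvPowerSeries.eulerDerivation 2))
variable (p : ℕ) [Fact p.Prime]

/-! ## The four test monomials `X₀^p, X₁^p, X₁^{p-1}X₂, X₂^p`

Their exponent vectors are carried as a variable `E : Fin 4 → (Fin 3 →₀ ℕ)` with its defining
equation `hE` (no definition is declared). -/

variable (E : Fin 4 → (Fin 3 →₀ ℕ))
  (hE : E = ![equivFunOnFinite.symm ![p, 0, 0], equivFunOnFinite.symm ![0, p, 0],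
    equivFunOnFinite.symm ![0, p - 1, 1], equivFunOnFinite.symm ![0, 0, p]])

section Exponents

include hE

/-- The four test exponents are pairwise distinct. [folklore] -/
theorem E_injective : Function.Injective E := by
  have hp : p.Prime := Fact.out
  have hp2 : 2 ≤ p := hp.two_le
  subst hE
  intro i j h
  have h0 := DFunLike.congr_fun h 0
  have h1 := DFunLike.congr_fun h 1
  have h2 := DFunLike.congr_fun h 2
  fin_cases i <;> fin_cases j <;> simp at h0 h1 h2 ⊢ <;> omega

/-- The test exponents are non-zero. [folklore] -/
theorem E_ne_zero (i : Fin 4) : E i ≠ 0 := by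
  have hp : p.Prime := Fact.out
  have hp2 : 2 ≤ p := hp.two_le
  subst hE
  intro h
  have h0 := DFunLike.congr_fun h 0
  have h1 := DFunLike.congr_fun h 1
  have h2 := DFunLike.congr_fun h 2
  fin_cases i <;> simp at h0 h1 h2 <;> omega

variable [CharP k p]
include hD

/-- Constants vanish on every monomial strictly between `1` and a test monomial. [folklore] -/
theorem coeff_eq_zero_of_lt_E {φ : MvPowerSeries (Fin 3) k} (hφ : D φ = 0) (i : Fin 4)
    {a : Fin 3 →₀ ℕ} (ha : a ≤ E i) (ha0 : a ≠ 0) (haE : a ≠ E i) : coeff a φ = 0 := by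
  have hp : p.Prime := Fact.out
  have hp2 : 2 ≤ p := hp.two_le
  subst hE
  have h0 := ha 0
  have h1 := ha 1
  have h2 := ha 2
  have hne0 : ¬ (a 0 = 0 ∧ a 1 = 0 ∧ a 2 = 0) := fun h => ha0 (by
    ext j; fin_cases j
    · exact h.1
    · exact h.2.1
    · exact h.2.2)
  have hneE : ¬ (a 0 = _ ∧ a 1 = _ ∧ a 2 = _) := fun h => haE (by
    ext j; fin_cases j
    · exact h.1
    · exact h.2.1
    · exact h.2.2)
  rw [fs_eq a]
  fin_cases i <;> simp at h0 h1 h2 hne0 hneE ⊢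
  · -- `X₀^p`
    have ha1 : a 1 = 0 := by omega
    have ha2 : a 2 = 0 := by omega
    rw [ha1, ha2]
    refine coeff_X0pow_eq_zero k D hD p hφ (by omega) fun hd => ?_
    have := Nat.le_of_dvd (by omega) hd
    omega
  · -- `X₁^p`
    have ha0' : a 0 = 0 := by omega
    rw [ha0']
    refine coeff_fs_zero_eq_zero k D hD p hφ fun hd => ?_
    have := Nat.le_of_dvd (by omega) hd
    omega
  · -- `X₁^{p-1} X₂`
    have ha0' : a 0 = 0 := by omega
    rw [ha0']
    refine coeff_fs_zero_eq_zero k D hD p hφ fun hd => ?_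
    have := Nat.le_of_dvd (by omega) hd
    omega
  · -- `X₂^p`
    have ha0' : a 0 = 0 := by omega
    rw [ha0']
    refine coeff_fs_zero_eq_zero k D hD p hφ fun hd => ?_
    have := Nat.le_of_dvd (by omega) hd
    omega

omit hE in
/-- A monomial all of whose exponents are divisible by `p` is a constant. [folklore] -/
theorem D_monomial_of_dvd {n : Fin 3 →₀ ℕ} (hn : ∀ i, p ∣ n i) : D (monomial n (1 : k)) = 0 := by
  classical
  apply D_eq_zero_of_mem_pSeriesSubring k D hD p
  rw [mem_pSeriesSubring_iff]
  intro m
  refine ⟨Subfield.mem_top _, ?_⟩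
  rintro ⟨i, hi⟩
  rw [coeff_monomial]
  split_ifs with h
  · subst h; exact absurd (hn i) hi
  · rfl

/-- The four test monomials are constants. [folklore] -/
theorem D_monomial_E (i : Fin 4) : D (monomial (E i) (1 : k)) = 0 := by
  classical
  have hp : p.Prime := Fact.out
  have hp1 : 1 ≤ p := hp.one_lt.le
  subst hE
  fin_cases i
  · exact D_monomial_of_dvd k D hD p (n := equivFunOnFinite.symm ![p, 0, 0]) fun i => by
      fin_cases i <;> simp
  · exact D_monomial_of_dvd k D hD p (n := equivFunOnFinite.symm ![0, p, 0]) fun i => by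
      fin_cases i <;> simp
  · -- `X₁^{p-1} X₂`: `∂₀` kills it and the Euler factor is `(p - 1) + 1 = p = 0`
    show D (monomial (equivFunOnFinite.symm ![0, p - 1, 1]) (1 : k)) = 0
    ext m
    rw [coeff_D k D hD, (coeff m).map_zero, coeff_monomial, if_neg, mul_zero, zero_add]
    · split_ifs with hle
      · rw [coeff_monomial]
        split_ifs with hm
        · have hm1 : m 1 = p - 1 := by
            have := DFunLike.congr_fun hm 1
            simpa [Finsupp.tsub_apply] using this
          have hm2 : m 2 = 1 := by
            have := DFunLike.congr_fun hm 2
            simpa [Finsupp.tsub_apply] using this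
          rw [hm1, hm2, ← Nat.cast_add, Nat.sub_add_cancel hp1, CharP.cast_eq_zero, zero_mul]
        · rw [mul_zero]
      · rfl
    · intro h
      have := DFunLike.congr_fun h 0
      simp at this
  · exact D_monomial_of_dvd k D hD p (n := equivFunOnFinite.symm ![0, 0, p]) fun i => by
      fin_cases i <;> simp

/-- **Multiplicativity of the test coefficients**: for a constant `s` and any `g` without
constant term, the coefficient of a test monomial in `s·g` is `s(0)` times that of `g`. [folklore] -/
theorem coeff_E_mul {s g : MvPowerSeries (Fin 3) k} (hs : D s = 0) (hg0 : constantCoeff g = 0)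
    (i : Fin 4) : coeff (E i) (s * g) = constantCoeff s * coeff (E i) g := by
  classical
  rw [coeff_mul, Finset.sum_eq_single (0, E i)]
  · rw [coeff_zero_eq_constantCoeff_apply]
  · rintro ⟨a, b⟩ hab hne
    rw [Finset.mem_antidiagonal] at hab
    dsimp only at hab ⊢
    by_cases ha : a = 0
    · subst ha; rw [zero_add] at hab; subst hab; exact absurd rfl hne
    by_cases hb : b = 0
    · subst hb; rw [add_zero] at hab; subst hab
      rw [coeff_zero_eq_constantCoeff_apply, hg0, mul_zero]
    have hle : a ≤ E i := hab ▸ le_self_add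
    have hneE : a ≠ E i := fun h => hb (by rw [h] at hab; exact add_eq_left.mp hab)
    rw [coeff_eq_zero_of_lt_E k D hD p E hE hs i hle ha hneE, zero_mul]
  · intro h
    exact absurd (Finset.mem_antidiagonal.mpr (zero_add _)) h

end Exponents

/-! ## Rings of constants are not regular -/

section ConstantsRing

variable [CharP k p] (S : Subring (MvPowerSeries (Fin 3) k)) (hS : ∀ x, x ∈ S ↔ D x = 0)
include hS

/-- A constant lying in the maximal ideal of the ring of constants `S` has zero constant term (the
inverse of a unit constant is a constant). [folklore] -/
theorem constantCoeff_eq_zero_of_mem_maximalIdeal [IsLocalRing S] {g : S}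
    (hg : g ∈ maximalIdeal S) : constantCoeff (g : MvPowerSeries (Fin 3) k) = 0 := by
  by_contra h
  have hu : IsUnit (g : MvPowerSeries (Fin 3) k) :=
    MvPowerSeries.isUnit_iff_constantCoeff.mpr (isUnit_iff_ne_zero.mpr h)
  obtain ⟨u, hu'⟩ := hu
  have hvg : (↑u⁻¹ : MvPowerSeries (Fin 3) k) * (g : MvPowerSeries (Fin 3) k) = 1 := by
    rw [← hu', Units.inv_mul]
  have hgv : (g : MvPowerSeries (Fin 3) k) * (↑u⁻¹ : MvPowerSeries (Fin 3) k) = 1 := by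
    rw [← hu', Units.mul_inv]
  have hv : (↑u⁻¹ : MvPowerSeries (Fin 3) k) ∈ S := by
    rw [hS, Derivation.leibniz_of_mul_eq_one _ hvg, (hS _).mp g.2, smul_zero]
  apply (IsLocalRing.mem_maximalIdeal _).mp hg
  exact ⟨⟨g, ⟨_, hv⟩, Subtype.ext hgv, Subtype.ext hvg⟩, rfl⟩

include hD hE

/-- The test monomials lie in `S`. [folklore] -/
theorem monomial_E_mem (i : Fin 4) : (monomial (E i) (1 : k) : MvPowerSeries (Fin 3) k) ∈ S :=
  (hS _).mpr (D_monomial_E k D hD p E hE i)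

/-- The test monomials lie in the maximal ideal of `S`. [folklore] -/
theorem monomialE_mem_maximalIdeal [IsLocalRing S] (i : Fin 4) :
    (⟨monomial (E i) 1, monomial_E_mem k D hD p E hE S hS i⟩ : S) ∈ maximalIdeal S := by
  classical
  rw [IsLocalRing.mem_maximalIdeal, mem_nonunits_iff]
  intro hu
  have hu' : IsUnit (monomial (E i) (1 : k) : MvPowerSeries (Fin 3) k) := hu.map S.subtype
  rw [MvPowerSeries.isUnit_iff_constantCoeff, ← coeff_zero_eq_constantCoeff_apply, coeff_monomial,
    if_neg (Ne.symm (E_ne_zero p E hE i))] at hu'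
  exact not_isUnit_zero hu'

/-- **A ring of constants `S = ker D` is not a regular local ring** (it is the `(1/p)(1,1)` cyclic
quotient singularity times a line: `dim S = 3` but `𝔪_S` needs at least `4` generators, witnessed
by the test monomials `X₀^p, X₁^p, X₁^{p-1}X₂, X₂^p`). [folklore] -/
theorem not_isRegularLocalRing_constants : ¬ IsRegularLocalRing S := by
  classical
  intro hreg
  haveI : Module.Finite S (MvPowerSeries (Fin 3) k) :=
    moduleFinite_of_constants k D hD p S fun x hx => (hS x).mpr hx
  -- dimension 3
  have hdim : ringKrullDim S = 3 := by
    rw [Literature.RingTheory.KrullDimension.ringKrullDim_eq_of_isIntegral (R := S)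
      (S := MvPowerSeries (Fin 3) k) Subtype.val_injective, ringKrullDim_mvPowerSeries]
    simp
  -- hence the maximal ideal has a generating set of three elements
  have h3 : (maximalIdeal S).spanFinrank = 3 := by
    have := hreg.spanFinrank_maximalIdeal
    rw [hdim] at this
    exact_mod_cast this
  obtain ⟨G, hG, hGspan⟩ :=
    Submodule.FG.exists_span_finset_card_eq_spanFinrank (IsNoetherian.noetherian (maximalIdeal S))
  -- the test functional
  let Λ : MvPowerSeries (Fin 3) k →ₗ[k] (Fin 4 → k) := LinearMap.pi fun i => coeff (E i)
  let W : Submodule k (Fin 4 → k) :=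
    Submodule.span k (G.image fun g : S => Λ (g : MvPowerSeries (Fin 3) k))
  have hW : ∀ u ∈ maximalIdeal S, Λ (u : MvPowerSeries (Fin 3) k) ∈ W := by
    intro u hu
    rw [← hGspan, Submodule.mem_span_finset] at hu
    obtain ⟨f, -, rfl⟩ := hu
    rw [AddSubmonoidClass.coe_finsetSum, map_sum]
    refine Submodule.sum_mem _ fun g hg => ?_
    have hgmax : g ∈ maximalIdeal S := by rw [← hGspan]; exact Submodule.subset_span hg
    have : Λ ((f g • g : S) : MvPowerSeries (Fin 3) k) =
        constantCoeff (f g : MvPowerSeries (Fin 3) k) • Λ (g : MvPowerSeries (Fin 3) k) := by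
      ext i
      simp only [Λ, LinearMap.pi_apply, Pi.smul_apply, smul_eq_mul]
      exact coeff_E_mul k D hD p E hE ((hS _).mp (f g).2)
        (constantCoeff_eq_zero_of_mem_maximalIdeal k D S hS hgmax) i
    rw [this]
    exact Submodule.smul_mem _ _ (Submodule.subset_span (Finset.mem_image_of_mem _ hg))
  -- `W` is everything
  have htop : (⊤ : Submodule k (Fin 4 → k)) ≤ W := by
    rw [← (Pi.basisFun k (Fin 4)).span_eq, Submodule.span_le]
    rintro _ ⟨i, rfl⟩
    have hΛ : Λ (monomial (E i) (1 : k)) = Pi.basisFun k (Fin 4) i := by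
      ext j
      simp only [Λ, LinearMap.pi_apply, Pi.basisFun_apply, coeff_monomial, Pi.single_apply]
      by_cases hji : j = i
      · subst hji; simp
      · rw [if_neg (fun h => hji (E_injective p E hE h)), if_neg hji]
    rw [SetLike.mem_coe, ← hΛ]
    exact hW _ (monomialE_mem_maximalIdeal k D hD p E hE S hS i)
  -- dimension count: `4 ≤ dim W ≤ 3`
  have h4 : Module.finrank k (Fin 4 → k) ≤ Module.finrank k W :=
    (finrank_top k (Fin 4 → k)).symm.le.trans (Submodule.finrank_mono htop)
  have hle : Module.finrank k W ≤ 3 :=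
    (finrank_span_finset_le_card _).trans (Finset.card_image_le.trans (hG.trans h3).le)
  rw [Module.finrank_fin_fun] at h4
  omega

end ConstantsRing

/-! ## The card lemma is false -/

/-- **The card lemma `InvariantsRegularOfNonsingularDerivation p` (card constant-foliation-descent,
SketchIdeator1; `Cruxes/DescentPerfectToAll/Disproof.lean` §8, stated there as a `def`) is false for
every prime `p`** — "if `R` is a regular local ring of characteristic `p`, `D` a derivation of `R`
with a unit value, `S = ker D` and `R` module-finite over `S`, then `S` is regular local" fails:
p-closedness of `D` cannot be dropped. Witness `R = 𝔽_p⟦X₀,X₁,X₂⟧`,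
`D = ∂₀ + X₀(X₁∂₁ + X₂∂₂)` (`D X₀ = 1`, `R` finite over `𝔽_p⟦X^p⟧ ⊆ ker D`, `ker D` not regular).
The negated proposition is spelled out verbatim so that the `def` of the Disproof file unfolds to it.
[folklore] -/
theorem not_invariantsRegularOfNonsingularDerivation :
    ¬ (∀ (R : Type) [CommRing R] [IsRegularLocalRing R] [CharP R p] (D : Derivation ℤ R R)
        (S : Subring R), (∀ x : R, x ∈ S ↔ D x = 0) → Module.Finite S R →
        (∃ x : R, IsUnit (D x)) → IsRegularLocalRing S) := by
  intro h
  haveI : IsRegularLocalRing (MvPowerSeries (Fin 3) (ZMod p)) :=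
    isRegularLocalRing_mvPowerSeries (ZMod p) (Fin 3)
  haveI : CharP (MvPowerSeries (Fin 3) (ZMod p)) p :=
    charP_of_injective_algebraMap (MvPowerSeries.C_injective : Function.Injective
      (algebraMap (ZMod p) (MvPowerSeries (Fin 3) (ZMod p)))) p
  -- the twisted derivation over `𝔽_p`
  let D₀ : Derivation (ZMod p) (MvPowerSeries (Fin 3) (ZMod p)) (MvPowerSeries (Fin 3) (ZMod p)) :=
    MvPowerSeries.pderiv 0 + (X 0 : MvPowerSeries (Fin 3) (ZMod p)) •
      (MvPowerSeries.eulerDerivation 1 + MvPowerSeries.eulerDerivation 2)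
  have hD₀ : D₀ = MvPowerSeries.pderiv 0 + (X 0 : MvPowerSeries (Fin 3) (ZMod p)) •
      (MvPowerSeries.eulerDerivation 1 + MvPowerSeries.eulerDerivation 2) := rfl
  -- the ring of constants, as a subring
  let S₀ : Subring (MvPowerSeries (Fin 3) (ZMod p)) :=
    { carrier := {φ | D₀ φ = 0}
      mul_mem' := fun {a b} ha hb => D_mul_eq_zero (ZMod p) D₀ ha hb
      one_mem' := by simp
      add_mem' := fun {a b} ha hb => by
        simp only [Set.mem_setOf_eq] at ha hb ⊢
        rw [map_add, ha, hb, add_zero]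
      zero_mem' := by simp
      neg_mem' := fun {a} ha => by
        simp only [Set.mem_setOf_eq] at ha ⊢
        rw [map_neg, ha, neg_zero] }
  have hS₀ : ∀ x, x ∈ S₀ ↔ D₀ x = 0 := fun _ => Iff.rfl
  -- the derivation, as a `ℤ`-derivation for the canonical `ℤ`-algebra structure of the card
  let δ : @Derivation ℤ (MvPowerSeries (Fin 3) (ZMod p)) (MvPowerSeries (Fin 3) (ZMod p)) _ _ _
      (Ring.toIntAlgebra _) _ _ :=
    @Derivation.mk' ℤ _ (MvPowerSeries (Fin 3) (ZMod p)) _ (Ring.toIntAlgebra _)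
      (MvPowerSeries (Fin 3) (ZMod p)) _ _ _
      D₀.toLinearMap.toAddMonoidHom.toIntLinearMap fun a b => by
        rw [AddMonoidHom.coe_toIntLinearMap, LinearMap.toAddMonoidHom_coe, Derivation.coeFn_coe,
          Derivation.leibniz]
  have hδ : ∀ x, δ x = D₀ x := fun _ => rfl
  exact not_isRegularLocalRing_constants (ZMod p) D₀ hD₀ p _ rfl S₀ hS₀
    (h (MvPowerSeries (Fin 3) (ZMod p)) δ S₀ (fun x => by rw [hδ]; exact hS₀ x)
      (moduleFinite_of_constants (ZMod p) D₀ hD₀ p S₀ fun x hx => (hS₀ x).mpr hx)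
      ⟨X 0, by rw [hδ, D_X_zero (ZMod p) D₀ hD₀]; exact isUnit_one⟩)

end Summit.ResolutionOfSingularities.ResolutionOfSingularities.Theorems.DescentPerfectToAll.Negative
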